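import Summits.CriticalPhenomena.Ising3DConformalLimit.Theorems.EnergyNotSigmaSquaredMoebiusLimitExistsPedigreeDefs
import Mathlib.Topology.MetricSpace.Thickening
import HarnessLib

/-! # Compact non-coincident thickenings of the doubled configurations of a mirror cut (stub doubled_thickening of line only-interaction-breaks-moebius, crux MoebiusLimitExists, item stmt-CriticalPhenomena-1344, route EnergyNotSigmaSquared) -/

noncomputable section

open Filter Topology Set Function Metric
open Literature.Probability.LatticeModels

namespace Summit.CriticalPhenomena.Ising3DConformalLimit.MoebiusLimitExistsOnlyInteraction

/-! ### The mirror on `ℝ³`: reversal of the functional, involutivity, continuity -/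

/-- `zdot g g` cast to `ℝ` is the sum of the squares of the entries of `g`. [folklore] -/
theorem cast_zdot_self_dt (g : Site 3) :
    ((zdot g g : ℤ) : ℝ) =
      (g 0 : ℝ) * (g 0 : ℝ) + (g 1 : ℝ) * (g 1 : ℝ) + (g 2 : ℝ) * (g 2 : ℝ) := by
  simp only [zdot, Int.cast_add, Int.cast_mul]

/-- For a cubic direction, `zdot g g ≠ 0` in `ℝ`. [folklore] -/
theorem cast_zdot_self_ne_zero_dt {g : Site 3} (hg : IsCubicDir g) : ((zdot g g : ℤ) : ℝ) ≠ 0 := by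
  rcases hg.2 with h | h <;> simp [h]

/-- The mirror reverses the functional: `rdotZ g (θ v) = 2T − rdotZ g v`. [folklore] -/
theorem rdotZ_reflectZ_dt {g : Site 3} (hg : IsCubicDir g) (T : ℝ) (v : EuclideanSpace ℝ (Fin 3)) :
    rdotZ g (reflectZ g T v) = 2 * T - rdotZ g v := by
  have hmul : ((g 0 : ℝ) * (g 0 : ℝ) + (g 1 : ℝ) * (g 1 : ℝ) + (g 2 : ℝ) * (g 2 : ℝ)) *
      ((zdot g g : ℤ) : ℝ)⁻¹ = 1 := by
    rw [← cast_zdot_self_dt]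
    exact mul_inv_cancel₀ (cast_zdot_self_ne_zero_dt hg)
  simp only [rdotZ, reflectZ_apply, div_eq_mul_inv]
  linear_combination (-2 * ((g 0 : ℝ) * v 0 + (g 1 : ℝ) * v 1 + (g 2 : ℝ) * v 2 - T)) * hmul

/-- The mirror is an involution. [folklore] -/
theorem reflectZ_reflectZ_dt {g : Site 3} (hg : IsCubicDir g) (T : ℝ)
    (v : EuclideanSpace ℝ (Fin 3)) : reflectZ g T (reflectZ g T v) = v := by
  ext j
  simp only [reflectZ_apply, rdotZ_reflectZ_dt hg]
  ring

/-- The mirror is injective. [folklore] -/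
theorem reflectZ_injective_dt {g : Site 3} (hg : IsCubicDir g) (T : ℝ) :
    Function.Injective (reflectZ g T) :=
  Function.LeftInverse.injective (g := reflectZ g T) (reflectZ_reflectZ_dt hg T)

/-- The functional `rdotZ g` is continuous. [folklore] -/
theorem continuous_rdotZ_dt (g : Site 3) : Continuous (rdotZ g) := by
  unfold rdotZ
  fun_prop

/-- The mirror is continuous. [folklore] -/
theorem continuous_reflectZ_dt (g : Site 3) (T : ℝ) : Continuous (reflectZ g T) := by
  have h := continuous_rdotZ_dt g
  unfold reflectZ
  fun_prop

/-! ### The doubled configurations: continuity and injectivity -/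

/-- `doubledA g T` is continuous in the configuration. [folklore] -/
theorem continuous_doubledA_dt (g : Site 3) (T : ℝ) (a b : ℕ) :
    Continuous (doubledA (a := a) (b := b) g T) := by
  refine continuous_pi fun k => ?_
  induction k using Fin.addCases with
  | left j =>
    simp only [doubledA_left]
    exact continuous_apply _
  | right j =>
    simp only [doubledA_right]
    exact (continuous_reflectZ_dt g T).comp (continuous_apply _)

/-- `doubledB g T` is continuous in the configuration. [folklore] -/
theorem continuous_doubledB_dt (g : Site 3) (T : ℝ) (a b : ℕ) :
    Continuous (doubledB (a := a) (b := b) g T) := by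
  refine continuous_pi fun k => ?_
  induction k using Fin.addCases with
  | left j =>
    simp only [doubledB_left]
    exact (continuous_reflectZ_dt g T).comp (continuous_apply _)
  | right j =>
    simp only [doubledB_right]
    exact continuous_apply _

/-- On a non-coincident configuration whose kept cluster lies at margin `μ > 0` below the mirror,
`doubledA` is injective: kept points stay below, mirrored points land above. [folklore] -/
theorem doubledA_injective_dt {g : Site 3} (hg : IsCubicDir g) {T μ : ℝ} (hμ : 0 < μ) {a b : ℕ}
    {x : Fin (a + b) → EuclideanSpace ℝ (Fin 3)} (hx : Function.Injective x)
    (hA : ∀ j : Fin a, rdotZ g (x (Fin.castAdd b j)) + μ ≤ T) :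
    Function.Injective (doubledA g T x) := by
  intro k l hkl
  induction k using Fin.addCases with
  | left k =>
    induction l using Fin.addCases with
    | left l =>
      simp only [doubledA_left] at hkl
      rw [Fin.castAdd_injective _ _ (hx hkl)]
    | right l =>
      exfalso
      simp only [doubledA_left, doubledA_right] at hkl
      have h := congrArg (rdotZ g) hkl
      rw [rdotZ_reflectZ_dt hg] at h
      linarith [hA k, hA l]
  | right k =>
    induction l using Fin.addCases with
    | left l =>
      exfalso
      simp only [doubledA_left, doubledA_right] at hkl
      have h := congrArg (rdotZ g) hkl
      rw [rdotZ_reflectZ_dt hg] at h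
      linarith [hA k, hA l]
    | right l =>
      simp only [doubledA_right] at hkl
      rw [Fin.castAdd_injective _ _ (hx (reflectZ_injective_dt hg T hkl))]

/-- On a non-coincident configuration whose discarded block lies at margin `μ > 0` above the
mirror, `doubledB` is injective. [folklore] -/
theorem doubledB_injective_dt {g : Site 3} (hg : IsCubicDir g) {T μ : ℝ} (hμ : 0 < μ) {a b : ℕ}
    {x : Fin (a + b) → EuclideanSpace ℝ (Fin 3)} (hx : Function.Injective x)
    (hB : ∀ j : Fin b, T + μ ≤ rdotZ g (x (Fin.natAdd a j))) :
    Function.Injective (doubledB g T x) := by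
  intro k l hkl
  induction k using Fin.addCases with
  | left k =>
    induction l using Fin.addCases with
    | left l =>
      simp only [doubledB_left] at hkl
      rw [Fin.natAdd_injective _ _ (hx (reflectZ_injective_dt hg T hkl))]
    | right l =>
      exfalso
      simp only [doubledB_left, doubledB_right] at hkl
      have h := congrArg (rdotZ g) hkl
      rw [rdotZ_reflectZ_dt hg] at h
      linarith [hB k, hB l]
  | right k =>
    induction l using Fin.addCases with
    | left l =>
      exfalso
      simp only [doubledB_left, doubledB_right] at hkl
      have h := congrArg (rdotZ g) hkl
      rw [rdotZ_reflectZ_dt hg] at h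
      linarith [hB k, hB l]
    | right l =>
      simp only [doubledB_right] at hkl
      rw [Fin.natAdd_injective _ _ (hx hkl)]

/-! ### The registered statement -/

/-- COMPACT NON-COINCIDENT THICKENINGS OF THE DOUBLED CONFIGURATIONS. For a cubic direction `g`, a
threshold `T`, a margin `μ > 0` and a compact set `K` of non-coincident configurations
`x = (x_A, x_B) : Fin (a + b) → ℝ³` with `rdotZ g ≤ T − μ` on the cluster `A` and `rdotZ g ≥ T + μ`
on the block `B`, there is `η₀ > 0` such that the closed `η₀`-thickenings of the images
`doubledA g T '' K` (`A ∪ θA`) and `doubledB g T '' K` (`θB ∪ B`) are compact and consist of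
non-coincident configurations: the doubled maps are continuous, injectivity is preserved because
the mirror `θ` is injective and sends `{rdotZ g ≤ T − μ}` into `{rdotZ g ≥ T + μ}`, and a compact
subset of the open set `NonCoincident` has a closed thickening inside it, compact since
`(ℝ³)ⁿ` is proper. [folklore] -/
theorem doubled_thickening :
    ∀ (g : Site 3), IsCubicDir g → ∀ (T μ : ℝ), 0 < μ → ∀ (a b : ℕ)
      (K : Set (Fin (a + b) → EuclideanSpace ℝ (Fin 3))), IsCompact K → K ⊆ NonCoincident 3 (a + b) →
      (∀ x ∈ K, (∀ j : Fin a, rdotZ g (x (Fin.castAdd b j)) + μ ≤ T) ∧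
        (∀ j : Fin b, T + μ ≤ rdotZ g (x (Fin.natAdd a j)))) →
      ∃ η₀ > 0, IsCompact (Metric.cthickening η₀ (doubledA g T '' K)) ∧
        Metric.cthickening η₀ (doubledA g T '' K) ⊆ NonCoincident 3 (a + a) ∧
        IsCompact (Metric.cthickening η₀ (doubledB g T '' K)) ∧
        Metric.cthickening η₀ (doubledB g T '' K) ⊆ NonCoincident 3 (b + b) := by
  intro g hg T μ hμ a b K hK hKnc hmargin
  have hcA : IsCompact (doubledA g T '' K) := hK.image (continuous_doubledA_dt g T a b)
  have hcB : IsCompact (doubledB g T '' K) := hK.image (continuous_doubledB_dt g T a b)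
  have hiA : doubledA g T '' K ⊆ NonCoincident 3 (a + a) := by
    rintro _ ⟨x, hx, rfl⟩
    exact (mem_nonCoincident _).2
      (doubledA_injective_dt hg hμ ((mem_nonCoincident x).1 (hKnc hx)) (hmargin x hx).1)
  have hiB : doubledB g T '' K ⊆ NonCoincident 3 (b + b) := by
    rintro _ ⟨x, hx, rfl⟩
    exact (mem_nonCoincident _).2
      (doubledB_injective_dt hg hμ ((mem_nonCoincident x).1 (hKnc hx)) (hmargin x hx).2)
  obtain ⟨δA, hδA, hsA⟩ :=
    hcA.exists_cthickening_subset_open (isOpen_nonCoincident 3 (a + a)) hiA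
  obtain ⟨δB, hδB, hsB⟩ :=
    hcB.exists_cthickening_subset_open (isOpen_nonCoincident 3 (b + b)) hiB
  refine ⟨min δA δB, lt_min hδA hδB, hcA.cthickening, ?_, hcB.cthickening, ?_⟩
  · exact (cthickening_mono (min_le_left _ _) _).trans hsA
  · exact (cthickening_mono (min_le_right _ _) _).trans hsB

end Summit.CriticalPhenomena.Ising3DConformalLimit.MoebiusLimitExistsOnlyInteraction

end
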